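import Mathlib
import Summits.NavierStokesRegularity.NavierStokesRegularity.Theorems.FilamentSkeletonRssClause13TransportFence

/-!
# Clause 13-J, brick B7-avg: the J-AVERAGING NORMAL FORM on the far transport branch, in complex notation, and the
# resulting sup bounds `|Y_far| ≤ (1 + O(d/G))·‖F‖/β̄`

Route `FilamentSkeletonRss`, child 28296 `Clause13NearStraight` (and its A1L twin); design of record
`filament-plan/DESIGN-NOTE-28296-tenure-g22.md` §3 (I1) ("the anisotropic part is averaged away by the own-core rotation wherever the
rotation rate ≫ d … Normal form: conjugate by e^K, K = O(d/G), error O(d²/G)") + (I2) outer/inner regions; lane memo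
`DESIGN-28296-transport-g13.md` §3 (H).  On the far branch the linearised map is, after freezing, the 2×2 transport system
`w·Y′ = (G·J + B)Y + F` on the normal plane.  Identify the normal plane with `ℂ` (`J = i`); a real-linear `B` splits as `B y = α y + β ȳ`
(`Re α = ½ tr B = β̄` of (I1), `|β| = d` the anisotropy), so `w·z′ = iG z + α z + β z̄ + f`.  This file proves:

* `rotatingFrame` : with `w θ′ = G`, `u = e^{−iθ} z` solves `w·u′ = α u + β e^{−2iθ} ū + e^{−iθ} f`;
* `normalForm_identity` : for `κ = −iβ/(2G)` the variable `v = u + κ e^{−2iθ} ū` solves `w·v′ = (α + κβ̄) v + R`,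
  `R = κ e^{−2iθ} ū(ᾱ − α − κβ̄) + (g + κ e^{−2iθ} ḡ)` — the anti-linear part is conjugated away to first order (`K = κ e^{−2iθ}·conj`,
  `‖K‖ = |β|/(2G)`), the shift `κβ̄ = −i|β|²/(2G)` is purely imaginary (`re_kappa_mul_conj`), and the error is `O(|β|(|Im α| + |β|²/G)/G)`;
* `radial_identity` : `w·⟪v′, v⟫_ℝ = Re(α + κβ̄)‖v‖² + ⟪R, v⟫_ℝ`;
* `farBranch_norm_le_of_amplified` : OUTER REGION — if `β₀ ≤ Re α − (k/(1−k))(2|Im α| + k|β|)` (`k = |β|/(2G) ≤ ½`), `‖g‖ ≤ M`,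
  `w > 0` and `u` vanishes at the outer end, then `‖u‖ ≤ ((1+k)M/β₀)/(1−k)` on the interval (backward fence of
  `…Clause13TransportFence`);
* `farBranch_norm_le_of_damped` : INNER REGION twin under J-averaged damping `β₀ ≤ −Re α − …` and `‖u a‖ ≤ M/β₀`.

Constant coefficients `α, β, G` (the frozen model; the class makes them vary on the partner scale `ρ√Γ`, note §6 (a) — the variable
version adds `w κ′`-terms of relative size `w|β′|/G`).  Typing-agnostic (A1G/A1L), natively `L∞`.  Lane ns-filament-19175-p1 g13;
`--supports stmt-NavierStokesRegularity-28296 --as helper`.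
HONEST FRAMING: ODE lemmas for the bookkeeping of a HYPOTHETICAL filament skeleton on the NEGATIVE side of a MODEL route; nothing here
bears on Navier–Stokes regularity or blow-up.
-/

noncomputable section

open scoped InnerProductSpace ComplexConjugate
open Set Complex

namespace Summit.NavierStokesRegularity.NavierStokesRegularity.Theorems.Clause13Transport
set_option linter.dupNamespace false

/-- The rotating-frame phase `E(s) = e^{−2iθ(s)}` has derivative `E·(−2iθ′)`. [folklore] -/
theorem hasDerivAt_phase {θ : ℝ → ℝ} {θ' τ : ℝ} (hθ : HasDerivAt θ θ' τ) :
    HasDerivAt (fun s => cexp (-2 * I * (θ s : ℂ))) (cexp (-2 * I * (θ τ : ℂ)) * (-2 * I * (θ' : ℂ))) τ := by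
  have h1 : HasDerivAt (fun s => -2 * I * (θ s : ℂ)) (-2 * I * (θ' : ℂ)) τ := by
    simpa using (hθ.ofReal_comp).const_mul (-2 * I)
  exact h1.cexp

/-- `conj e^{−2iθ} = e^{2iθ}` for real `θ`. [folklore] -/
theorem conj_phase (θ : ℝ) : conj (cexp (-2 * I * (θ : ℂ))) = cexp (2 * I * (θ : ℂ)) := by
  rw [← Complex.exp_conj]
  congr 1
  simp [map_mul, map_ofNat, Complex.conj_I, Complex.conj_ofReal]

/-- `e^{−2iθ}·conj(e^{−2iθ}) = 1` for real `θ`. [folklore] -/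
theorem phase_mul_conj_phase (θ : ℝ) : cexp (-2 * I * (θ : ℂ)) * conj (cexp (-2 * I * (θ : ℂ))) = 1 := by
  rw [conj_phase, ← Complex.exp_add]
  ring_nf
  exact Complex.exp_zero

/-- `‖e^{−2iθ}‖ = 1` for real `θ`. [folklore] -/
theorem norm_phase (θ : ℝ) : ‖cexp (-2 * I * (θ : ℂ))‖ = 1 := by
  have : -2 * I * (θ : ℂ) = I * ((-2 * θ : ℝ) : ℂ) := by push_cast; ring
  rw [this, Complex.norm_exp_I_mul_ofReal]

/-- Derivative of the normal-form variable `v = u + κ·e^{−2iθ}·ū`. [folklore] -/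
theorem hasDerivAt_normalForm {u : ℝ → ℂ} {u' : ℂ} {θ : ℝ → ℝ} {θ' τ : ℝ} (κ : ℂ)
    (hu : HasDerivAt u u' τ) (hθ : HasDerivAt θ θ' τ) :
    HasDerivAt (fun s => u s + κ * cexp (-2 * I * (θ s : ℂ)) * conj (u s))
      (u' + κ * (cexp (-2 * I * (θ τ : ℂ)) * (-2 * I * (θ' : ℂ))) * conj (u τ)
          + κ * cexp (-2 * I * (θ τ : ℂ)) * conj u') τ := by
  have hcu : HasDerivAt (fun s => conj (u s)) (conj u') τ := hu.star
  have hE := hasDerivAt_phase hθ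
  have h := hu.add (((hE.const_mul κ).mul hcu))
  have hfun : (fun s => u s + κ * cexp (-2 * I * (θ s : ℂ)) * conj (u s))
      = (u + (fun y => κ * cexp (-2 * I * (θ y : ℂ))) * fun s => conj (u s)) := by
    funext s; simp only [Pi.add_apply, Pi.mul_apply]
  rw [hfun]
  exact h.congr_deriv (by ring)

/-- **The averaging identity (constant coefficients).**  If `w·u′ = α·u + β·e^{−2iθ}·ū + g` (rotating-frame form of
`w·z′ = iG z + α z + β z̄ + f`, `z = e^{iθ}u`, `w θ′ = G`) and `2Gκ = −iβ`, then the normal-form variable `v = u + κ e^{−2iθ} ū` satisfies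
`w·v′ = (α + κβ̄)·v + R`, `R = κ e^{−2iθ} ū (ᾱ − α − κβ̄) + κ e^{−2iθ} ḡ`: the anti-linear (J-anti-commuting) part `β` is removed to first
order, at the price of the imaginary shift `κβ̄ = −i|β|²/(2G)` and a remainder `R − g` of size `|κ|(2|Im α| + |κβ|)|u| + |κ||g|`. [folklore] -/
theorem normalForm_identity {w θ' G : ℝ} {U u' E g α β κ : ℂ}
    (hθ : (w : ℂ) * θ' = G) (hκ : 2 * (G : ℂ) * κ = -I * β) (hE : E * conj E = 1)
    (heq : (w : ℂ) * u' = α * U + β * E * conj U + g) :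
    (w : ℂ) * (u' + κ * (E * (-2 * I * (θ' : ℂ))) * conj U + κ * E * conj u')
      = (α + κ * conj β) * (U + κ * E * conj U)
        + (κ * E * conj U * (conj α - α - κ * conj β) + (g + κ * E * conj g)) := by
  have heqc : (w : ℂ) * conj u' = conj α * conj U + conj β * conj E * U + conj g := by
    have := congrArg conj heq
    simpa [map_mul, map_add, Complex.conj_ofReal] using this
  linear_combination heq + κ * E * heqc + (-2 * I * κ * E * conj U) * hθ + κ * conj β * U * hE
    + (-I * E * conj U) * hκ + (β * E * conj U) * Complex.I_sq

/-! ### Small complex-number facts for the normal form -/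

/-- `‖−iβ/(2G)‖ = ‖β‖/(2G)` for `G > 0`. [folklore] -/
theorem norm_kappa {G : ℝ} (hG : 0 < G) (β : ℂ) : ‖-I * β / (2 * (G : ℂ))‖ = ‖β‖ / (2 * G) := by
  rw [norm_div, norm_mul, norm_neg, Complex.norm_I, one_mul]
  congr 1
  rw [show (2 : ℂ) * (G : ℂ) = ((2 * G : ℝ) : ℂ) by push_cast; ring, Complex.norm_real, Real.norm_eq_abs,
    abs_of_pos (by positivity)]

/-- With `2Gκ = −iβ` (`G ≠ 0`) the shift `κβ̄` is purely imaginary: `Re(κβ̄) = 0`. [folklore] -/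
theorem re_kappa_mul_conj {G : ℝ} (hG : G ≠ 0) {κ β : ℂ} (hκ : 2 * (G : ℂ) * κ = -I * β) : (κ * conj β).re = 0 := by
  have h : ((2 * G : ℝ) : ℂ) * (κ * conj β) = -I * ((Complex.normSq β : ℝ) : ℂ) := by
    rw [← Complex.mul_conj]
    push_cast
    linear_combination conj β * hκ
  have hre := congrArg Complex.re h
  rw [Complex.re_ofReal_mul] at hre
  have : (-I * ((Complex.normSq β : ℝ) : ℂ)).re = 0 := by simp
  rw [this] at hre
  have h2G : (2 * G : ℝ) ≠ 0 := by positivity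
  exact (mul_eq_zero.1 hre).resolve_left h2G

/-- `‖ᾱ − α‖ = 2|Im α|`. [folklore] -/
theorem norm_conj_sub_self (α : ℂ) : ‖conj α - α‖ = 2 * |α.im| := by
  have : conj α - α = ((-(2 * α.im) : ℝ) : ℂ) * I := by
    apply Complex.ext
    · simp
    · simp [two_mul]; ring
  rw [this, norm_mul, Complex.norm_I, mul_one, Complex.norm_real, Real.norm_eq_abs, abs_neg, abs_mul,
    abs_of_pos (by norm_num : (0:ℝ) < 2)]

/-- Radial identity: if `w·v′ = a·v + R` with `w` real then `w·⟪v′, v⟫_ℝ = Re a·‖v‖² + ⟪R, v⟫_ℝ`. [folklore] -/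
theorem radial_identity {w : ℝ} {v v' a R : ℂ} (h : (w : ℂ) * v' = a * v + R) :
    w * ⟪v', v⟫_ℝ = a.re * ‖v‖ ^ 2 + ⟪R, v⟫_ℝ := by
  simp only [Complex.inner]
  have h1 : (w : ℝ) * (v * conj v').re = (v * conj ((w : ℂ) * v')).re := by
    rw [map_mul, Complex.conj_ofReal]
    have : v * ((w : ℂ) * conj v') = (w : ℂ) * (v * conj v') := by ring
    rw [this, Complex.re_ofReal_mul]
  rw [h1, h, map_add, map_mul, mul_add]
  have h2 : (v * (conj a * conj v)).re = a.re * ‖v‖ ^ 2 := by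
    have : v * (conj a * conj v) = conj a * (v * conj v) := by ring
    rw [this, Complex.mul_conj, Complex.normSq_eq_norm_sq, Complex.re_mul_ofReal, Complex.conj_re]
  rw [Complex.add_re, h2]

/-! ### The far-branch sup bound: amplified transport after averaging, integrated inward -/

/-- **B7-avg, outer region.**  Let `u` solve the rotating-frame far-branch system `w·u′ = α·u + β·e^{−2iθ}·ū + g` on `[a, b]`
(`w θ′ = G > 0`, `w > 0`, `‖g‖ ≤ M`), with the anti-linear part small against the rotation, `‖β‖ ≤ G`, and J-AVERAGED GROWTH
`Re α` exceeding the averaging error: `β₀ ≤ Re α − (k/(1−k))·(2|Im α| + k‖β‖)`, `k = ‖β‖/(2G)`, `β₀ > 0`.  If `u` vanishes at the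
outer end `b` (ball edge), then `‖u τ‖ ≤ ((1 + k)M/β₀)/(1 − k)` on `[a, b]` — the bound `|Y_far| ≤ ‖F‖/β̄ · (1 + O(d/G))` of the
tenure note (I1)/(I2), outer region, with every constant explicit (normal form `v = u + κe^{−2iθ}ū`, `κ = −iβ/(2G)`,
`normalForm_identity`, `radial_identity`, and the backward fence `norm_le_of_le_inner_deriv`). [folklore] -/
theorem farBranch_norm_le_of_amplified {u u' g : ℝ → ℂ} {θ θ' w : ℝ → ℝ} {a b G M β₀ : ℝ} {α β : ℂ}
    (hG : 0 < G) (hM : 0 ≤ M) (hβ₀ : 0 < β₀)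
    (hu : ∀ τ ∈ Icc a b, HasDerivAt u (u' τ) τ) (hθ : ∀ τ ∈ Icc a b, HasDerivAt θ (θ' τ) τ)
    (hw : ∀ τ ∈ Icc a b, 0 < w τ) (hwθ : ∀ τ ∈ Icc a b, w τ * θ' τ = G)
    (hode : ∀ τ ∈ Icc a b, (w τ : ℂ) * u' τ = α * u τ + β * cexp (-2 * I * (θ τ : ℂ)) * conj (u τ) + g τ)
    (hg : ∀ τ ∈ Icc a b, ‖g τ‖ ≤ M) (hsmall : ‖β‖ ≤ G)
    (hgain : β₀ ≤ α.re - (‖β‖ / (2 * G)) / (1 - ‖β‖ / (2 * G)) * (2 * |α.im| + ‖β‖ / (2 * G) * ‖β‖))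
    (hb : u b = 0) :
    ∀ τ ∈ Icc a b, ‖u τ‖ ≤ ((1 + ‖β‖ / (2 * G)) * M / β₀) / (1 - ‖β‖ / (2 * G)) := by
  -- the normal-form data
  set κ : ℂ := -I * β / (2 * (G : ℂ)) with hκdef
  set k : ℝ := ‖β‖ / (2 * G) with hkdef
  have hκnorm : ‖κ‖ = k := norm_kappa hG β
  have hk0 : 0 ≤ k := by positivity
  have hk1 : k ≤ 1 / 2 := by
    rw [hkdef, div_le_iff₀ (by positivity)]; linarith
  have hk1' : 0 < 1 - k := by linarith
  have hG' : (G : ℂ) ≠ 0 := by exact_mod_cast hG.ne'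
  have hκeq : 2 * (G : ℂ) * κ = -I * β := by
    rw [hκdef]; field_simp
  set E : ℝ → ℂ := fun s => cexp (-2 * I * (θ s : ℂ)) with hEdef
  set v : ℝ → ℂ := fun s => u s + κ * E s * conj (u s) with hvdef
  set v' : ℝ → ℂ := fun s => u' s + κ * (E s * (-2 * I * (θ' s : ℂ))) * conj (u s) + κ * E s * conj (u' s) with hv'def
  have hEnorm : ∀ s, ‖E s‖ = 1 := fun s => norm_phase (θ s)
  have hEE : ∀ s, E s * conj (E s) = 1 := fun s => phase_mul_conj_phase (θ s)
  have hvder : ∀ τ ∈ Icc a b, HasDerivAt v (v' τ) τ := fun τ hτ => hasDerivAt_normalForm κ (hu τ hτ) (hθ τ hτ)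
  -- `‖u‖ ≤ ‖v‖/(1−k)`
  have huv : ∀ s, ‖u s‖ ≤ ‖v s‖ / (1 - k) := by
    intro s
    rw [le_div_iff₀ hk1']
    have h1 : ‖u s‖ ≤ ‖v s‖ + ‖κ * E s * conj (u s)‖ := by
      have : u s = v s - κ * E s * conj (u s) := by simp [hvdef]
      calc ‖u s‖ = ‖v s - κ * E s * conj (u s)‖ := by rw [← this]
        _ ≤ ‖v s‖ + ‖κ * E s * conj (u s)‖ := norm_sub_le _ _
    have h2 : ‖κ * E s * conj (u s)‖ = k * ‖u s‖ := by
      rw [norm_mul, norm_mul, hκnorm, hEnorm, mul_one, Complex.norm_conj]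
    rw [h2] at h1
    nlinarith
  -- the radial inequality for `v`
  have hrad : ∀ τ ∈ Ioc a b, (w τ)⁻¹ * (‖v τ‖ * (β₀ * ‖v τ‖ - (1 + k) * M)) ≤ ⟪v' τ, v τ⟫_ℝ := by
    intro τ hτ
    have hτ' : τ ∈ Icc a b := Ioc_subset_Icc_self hτ
    have hwτ := hw τ hτ'
    have hid := normalForm_identity (U := u τ) (u' := u' τ) (g := g τ) (α := α) (β := β)
      (by exact_mod_cast hwθ τ hτ') hκeq (hEE τ) (hode τ hτ')
    -- `w ⟪v', v⟫ = Re(α + κβ̄)‖v‖² + ⟪R, v⟫`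
    have hR := radial_identity (w := w τ) (v := v τ) (v' := v' τ) hid
    have hre : (α + κ * conj β).re = α.re := by
      rw [Complex.add_re, re_kappa_mul_conj hG.ne' hκeq, add_zero]
    rw [hre] at hR
    -- bound the remainder
    set R₁ : ℂ := κ * E τ * conj (u τ) * (conj α - α - κ * conj β) with hR₁
    set R₂ : ℂ := g τ + κ * E τ * conj (g τ) with hR₂
    have hR₁le : ‖R₁‖ ≤ k * ‖u τ‖ * (2 * |α.im| + k * ‖β‖) := by
      rw [hR₁, norm_mul, norm_mul, norm_mul, hκnorm, hEnorm, mul_one, Complex.norm_conj]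
      gcongr
      calc ‖conj α - α - κ * conj β‖ ≤ ‖conj α - α‖ + ‖κ * conj β‖ := norm_sub_le _ _
        _ = 2 * |α.im| + k * ‖β‖ := by rw [norm_conj_sub_self, norm_mul, hκnorm, Complex.norm_conj]
    have hR₂le : ‖R₂‖ ≤ (1 + k) * M := by
      rw [hR₂]
      calc ‖g τ + κ * E τ * conj (g τ)‖ ≤ ‖g τ‖ + ‖κ * E τ * conj (g τ)‖ := norm_add_le _ _
        _ = ‖g τ‖ + k * ‖g τ‖ := by rw [norm_mul, norm_mul, hκnorm, hEnorm, mul_one, Complex.norm_conj]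
        _ = (1 + k) * ‖g τ‖ := by ring
        _ ≤ (1 + k) * M := by gcongr; exact hg τ hτ'
    have hinner : -((‖R₁‖ + ‖R₂‖) * ‖v τ‖) ≤ ⟪R₁ + R₂, v τ⟫_ℝ := by
      have h1 := abs_real_inner_le_norm (R₁ + R₂) (v τ)
      have h2 : ‖R₁ + R₂‖ ≤ ‖R₁‖ + ‖R₂‖ := norm_add_le _ _
      have h3 : |⟪R₁ + R₂, v τ⟫_ℝ| ≤ (‖R₁‖ + ‖R₂‖) * ‖v τ‖ := h1.trans (by gcongr)
      linarith [abs_le.1 h3]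
    -- assemble: w⟪v',v⟫ ≥ Re α ‖v‖² − (‖R₁‖+‖R₂‖)‖v‖ ≥ (Re α − η)‖v‖² − (1+k)M‖v‖
    have hu' := huv τ
    have hv0 := norm_nonneg (v τ)
    have hη : ‖R₁‖ * ‖v τ‖ ≤ (k / (1 - k) * (2 * |α.im| + k * ‖β‖)) * ‖v τ‖ ^ 2 := by
      have : ‖R₁‖ ≤ (k / (1 - k) * (2 * |α.im| + k * ‖β‖)) * ‖v τ‖ := by
        calc ‖R₁‖ ≤ k * ‖u τ‖ * (2 * |α.im| + k * ‖β‖) := hR₁le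
          _ ≤ k * (‖v τ‖ / (1 - k)) * (2 * |α.im| + k * ‖β‖) := by gcongr
          _ = (k / (1 - k) * (2 * |α.im| + k * ‖β‖)) * ‖v τ‖ := by field_simp
      nlinarith
    have hmain : ‖v τ‖ * (β₀ * ‖v τ‖ - (1 + k) * M) ≤ w τ * ⟪v' τ, v τ⟫_ℝ := by
      rw [hR]
      have hg2 : β₀ * ‖v τ‖ ^ 2 ≤ (α.re - k / (1 - k) * (2 * |α.im| + k * ‖β‖)) * ‖v τ‖ ^ 2 :=
        mul_le_mul_of_nonneg_right hgain (sq_nonneg _)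
      nlinarith
    rw [inv_mul_le_iff₀ hwτ]
    exact hmain
  -- fence backward from `b`, where `v b = 0`
  have hvb : ‖v b‖ ≤ (1 + k) * M / β₀ := by
    have : v b = 0 := by simp [hvdef, hb]
    rw [this, norm_zero]; positivity
  have hMf : 0 ≤ (1 + k) * M := by positivity
  have hfence := norm_le_of_le_inner_deriv (ρ := fun τ => (w τ)⁻¹) hβ₀ hMf hvder
    (fun τ hτ => inv_pos.mpr (hw τ (Ioc_subset_Icc_self hτ))) hrad hvb
  intro τ hτ
  calc ‖u τ‖ ≤ ‖v τ‖ / (1 - k) := huv τ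
    _ ≤ ((1 + k) * M / β₀) / (1 - k) := by gcongr; exact hfence τ hτ

/-- **B7-avg, inner region (damped twin).**  Same system with J-averaged DAMPING: `β₀ ≤ −Re α − (k/(1−k))(2|Im α| + k‖β‖)`.
If `‖u a‖ ≤ M/β₀` at the inner end, then `‖u τ‖ ≤ ((1 + k)M/β₀)/(1 − k)` on `[a, b]` (forward fence `norm_le_of_inner_deriv_le`;
e.g. next to the waist in the rigid-core typing, where clause 12 gives `Re α = ¾ − w′/2 ≤ −δ/2`). [folklore] -/
theorem farBranch_norm_le_of_damped {u u' g : ℝ → ℂ} {θ θ' w : ℝ → ℝ} {a b G M β₀ : ℝ} {α β : ℂ}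
    (hG : 0 < G) (hM : 0 ≤ M) (hβ₀ : 0 < β₀)
    (hu : ∀ τ ∈ Icc a b, HasDerivAt u (u' τ) τ) (hθ : ∀ τ ∈ Icc a b, HasDerivAt θ (θ' τ) τ)
    (hw : ∀ τ ∈ Icc a b, 0 < w τ) (hwθ : ∀ τ ∈ Icc a b, w τ * θ' τ = G)
    (hode : ∀ τ ∈ Icc a b, (w τ : ℂ) * u' τ = α * u τ + β * cexp (-2 * I * (θ τ : ℂ)) * conj (u τ) + g τ)
    (hg : ∀ τ ∈ Icc a b, ‖g τ‖ ≤ M) (hsmall : ‖β‖ ≤ G)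
    (hgain : β₀ ≤ -α.re - (‖β‖ / (2 * G)) / (1 - ‖β‖ / (2 * G)) * (2 * |α.im| + ‖β‖ / (2 * G) * ‖β‖))
    (ha : ‖u a‖ ≤ M / β₀) :
    ∀ τ ∈ Icc a b, ‖u τ‖ ≤ ((1 + ‖β‖ / (2 * G)) * M / β₀) / (1 - ‖β‖ / (2 * G)) := by
  set κ : ℂ := -I * β / (2 * (G : ℂ)) with hκdef
  set k : ℝ := ‖β‖ / (2 * G) with hkdef
  have hκnorm : ‖κ‖ = k := norm_kappa hG β
  have hk0 : 0 ≤ k := by positivity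
  have hk1 : k ≤ 1 / 2 := by
    rw [hkdef, div_le_iff₀ (by positivity)]; linarith
  have hk1' : 0 < 1 - k := by linarith
  have hG' : (G : ℂ) ≠ 0 := by exact_mod_cast hG.ne'
  have hκeq : 2 * (G : ℂ) * κ = -I * β := by
    rw [hκdef]; field_simp
  set E : ℝ → ℂ := fun s => cexp (-2 * I * (θ s : ℂ)) with hEdef
  set v : ℝ → ℂ := fun s => u s + κ * E s * conj (u s) with hvdef
  set v' : ℝ → ℂ := fun s => u' s + κ * (E s * (-2 * I * (θ' s : ℂ))) * conj (u s) + κ * E s * conj (u' s) with hv'def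
  have hEnorm : ∀ s, ‖E s‖ = 1 := fun s => norm_phase (θ s)
  have hEE : ∀ s, E s * conj (E s) = 1 := fun s => phase_mul_conj_phase (θ s)
  have hvder : ∀ τ ∈ Icc a b, HasDerivAt v (v' τ) τ := fun τ hτ => hasDerivAt_normalForm κ (hu τ hτ) (hθ τ hτ)
  have hκE : ∀ s (z : ℂ), ‖κ * E s * conj z‖ = k * ‖z‖ := fun s z => by
    rw [norm_mul, norm_mul, hκnorm, hEnorm, mul_one, Complex.norm_conj]
  have huv : ∀ s, ‖u s‖ ≤ ‖v s‖ / (1 - k) := by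
    intro s
    rw [le_div_iff₀ hk1']
    have h1 : ‖u s‖ ≤ ‖v s‖ + ‖κ * E s * conj (u s)‖ := by
      have : u s = v s - κ * E s * conj (u s) := by simp [hvdef]
      calc ‖u s‖ = ‖v s - κ * E s * conj (u s)‖ := by rw [← this]
        _ ≤ ‖v s‖ + ‖κ * E s * conj (u s)‖ := norm_sub_le _ _
    rw [hκE] at h1
    nlinarith
  have hvu : ∀ s, ‖v s‖ ≤ (1 + k) * ‖u s‖ := by
    intro s
    calc ‖v s‖ ≤ ‖u s‖ + ‖κ * E s * conj (u s)‖ := norm_add_le _ _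
      _ = (1 + k) * ‖u s‖ := by rw [hκE]; ring
  -- radial inequality, damped form
  have hrad : ∀ τ ∈ Ico a b, ⟪v' τ, v τ⟫_ℝ ≤ (w τ)⁻¹ * (‖v τ‖ * ((1 + k) * M - β₀ * ‖v τ‖)) := by
    intro τ hτ
    have hτ' : τ ∈ Icc a b := Ico_subset_Icc_self hτ
    have hwτ := hw τ hτ'
    have hid := normalForm_identity (U := u τ) (u' := u' τ) (g := g τ) (α := α) (β := β)
      (by exact_mod_cast hwθ τ hτ') hκeq (hEE τ) (hode τ hτ')
    have hR := radial_identity (w := w τ) (v := v τ) (v' := v' τ) hid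
    have hre : (α + κ * conj β).re = α.re := by
      rw [Complex.add_re, re_kappa_mul_conj hG.ne' hκeq, add_zero]
    rw [hre] at hR
    set R₁ : ℂ := κ * E τ * conj (u τ) * (conj α - α - κ * conj β) with hR₁
    set R₂ : ℂ := g τ + κ * E τ * conj (g τ) with hR₂
    have hR₁le : ‖R₁‖ ≤ k * ‖u τ‖ * (2 * |α.im| + k * ‖β‖) := by
      rw [hR₁, norm_mul, hκE]
      gcongr
      calc ‖conj α - α - κ * conj β‖ ≤ ‖conj α - α‖ + ‖κ * conj β‖ := norm_sub_le _ _
        _ = 2 * |α.im| + k * ‖β‖ := by rw [norm_conj_sub_self, norm_mul, hκnorm, Complex.norm_conj]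
    have hR₂le : ‖R₂‖ ≤ (1 + k) * M := by
      rw [hR₂]
      calc ‖g τ + κ * E τ * conj (g τ)‖ ≤ ‖g τ‖ + ‖κ * E τ * conj (g τ)‖ := norm_add_le _ _
        _ = (1 + k) * ‖g τ‖ := by rw [hκE]; ring
        _ ≤ (1 + k) * M := by gcongr; exact hg τ hτ'
    have hinner : ⟪R₁ + R₂, v τ⟫_ℝ ≤ (‖R₁‖ + ‖R₂‖) * ‖v τ‖ := by
      have h1 := abs_real_inner_le_norm (R₁ + R₂) (v τ)
      have h3 : |⟪R₁ + R₂, v τ⟫_ℝ| ≤ (‖R₁‖ + ‖R₂‖) * ‖v τ‖ := h1.trans (by gcongr; exact norm_add_le _ _)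
      linarith [abs_le.1 h3]
    have hu' := huv τ
    have hv0 := norm_nonneg (v τ)
    have hη : ‖R₁‖ * ‖v τ‖ ≤ (k / (1 - k) * (2 * |α.im| + k * ‖β‖)) * ‖v τ‖ ^ 2 := by
      have : ‖R₁‖ ≤ (k / (1 - k) * (2 * |α.im| + k * ‖β‖)) * ‖v τ‖ := by
        calc ‖R₁‖ ≤ k * ‖u τ‖ * (2 * |α.im| + k * ‖β‖) := hR₁le
          _ ≤ k * (‖v τ‖ / (1 - k)) * (2 * |α.im| + k * ‖β‖) := by gcongr
          _ = (k / (1 - k) * (2 * |α.im| + k * ‖β‖)) * ‖v τ‖ := by field_simp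
      nlinarith
    have hmain : w τ * ⟪v' τ, v τ⟫_ℝ ≤ ‖v τ‖ * ((1 + k) * M - β₀ * ‖v τ‖) := by
      rw [hR]
      have hg2 : β₀ * ‖v τ‖ ^ 2 ≤ (-α.re - k / (1 - k) * (2 * |α.im| + k * ‖β‖)) * ‖v τ‖ ^ 2 :=
        mul_le_mul_of_nonneg_right hgain (sq_nonneg _)
      nlinarith
    rw [le_inv_mul_iff₀ hwτ]
    exact hmain
  have hva : ‖v a‖ ≤ (1 + k) * M / β₀ := by
    calc ‖v a‖ ≤ (1 + k) * ‖u a‖ := hvu a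
      _ ≤ (1 + k) * (M / β₀) := by gcongr
      _ = (1 + k) * M / β₀ := by ring
  have hMf : 0 ≤ (1 + k) * M := by positivity
  have hfence := norm_le_of_inner_deriv_le (ρ := fun τ => (w τ)⁻¹) hβ₀ hMf hvder
    (fun τ hτ => inv_pos.mpr (hw τ (Ico_subset_Icc_self hτ))) hrad hva
  intro τ hτ
  calc ‖u τ‖ ≤ ‖v τ‖ / (1 - k) := huv τ
    _ ≤ ((1 + k) * M / β₀) / (1 - k) := by gcongr; exact hfence τ hτ

/-! ### From the lab frame to the rotating frame -/

/-- **Rotating frame.**  If `w·z′ = iG·z + α·z + β·z̄ + f` (point rotation `G`, local gradient split into its complex-linear part `α`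
and anti-linear part `β`) and `w·θ′ = G`, then `u = e^{−iθ}z` solves `w·u′ = α·u + β·e^{−2iθ}·ū + e^{−iθ}f` — the form used above. [folklore] -/
theorem rotatingFrame {z : ℝ → ℂ} {z' f α β : ℂ} {θ : ℝ → ℝ} {θ' w G τ : ℝ}
    (hz : HasDerivAt z z' τ) (hθ : HasDerivAt θ θ' τ) (hwθ : w * θ' = G)
    (hode : (w : ℂ) * z' = I * G * z τ + α * z τ + β * conj (z τ) + f) :
    HasDerivAt (fun s => cexp (-I * (θ s : ℂ)) * z s)
        (cexp (-I * (θ τ : ℂ)) * (-I * (θ' : ℂ)) * z τ + cexp (-I * (θ τ : ℂ)) * z') τ ∧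
      (w : ℂ) * (cexp (-I * (θ τ : ℂ)) * (-I * (θ' : ℂ)) * z τ + cexp (-I * (θ τ : ℂ)) * z')
        = α * (cexp (-I * (θ τ : ℂ)) * z τ)
          + β * cexp (-2 * I * (θ τ : ℂ)) * conj (cexp (-I * (θ τ : ℂ)) * z τ)
          + cexp (-I * (θ τ : ℂ)) * f := by
  have h1 : HasDerivAt (fun s => -I * (θ s : ℂ)) (-I * (θ' : ℂ)) τ := by
    simpa using (hθ.ofReal_comp).const_mul (-I)
  refine ⟨(h1.cexp).mul hz, ?_⟩
  have hwθ' : (w : ℂ) * θ' = G := by exact_mod_cast hwθ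
  have hconj : conj (cexp (-I * (θ τ : ℂ)) * z τ) = cexp (I * (θ τ : ℂ)) * conj (z τ) := by
    rw [map_mul, ← Complex.exp_conj]
    congr 2
    simp [Complex.conj_I, Complex.conj_ofReal]
  have hexp : cexp (-2 * I * (θ τ : ℂ)) * cexp (I * (θ τ : ℂ)) = cexp (-I * (θ τ : ℂ)) := by
    rw [← Complex.exp_add]; ring_nf
  rw [hconj]
  linear_combination cexp (-I * (θ τ : ℂ)) * hode + (-I * cexp (-I * (θ τ : ℂ)) * z τ) * hwθ'
    - β * conj (z τ) * hexp

end Summit.NavierStokesRegularity.NavierStokesRegularity.Theorems.Clause13Transport
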